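/- Copyright: the b2b-balaban cell (near-miss cell 7), T⁴-continuum fan-out, lineage t4-ne7b-p1 (node U5c COUNT
member).  Released under the licence of the surrounding project. -/
import Summits.QuantumFields.BalabanUV.T4Continuum.Support.HistoryGenBridge
import Summits.QuantumFields.BalabanUV.T4Continuum.Support.HistoryGenealogyRealisePrint
import Summits.QuantumFields.BalabanUV.T4Continuum.Support.HistoryTouchComponents

/-!
# LEFT-NESTED join chains realised, and the OLDEST-FIRST contact order (H3-(ID); M4 brick 1 — the two order facts the
junction to the END's pedigree currency needs; owner module of row NE7b, lineage `t4-ne7b-p1` gen 40, M4 design memo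
D-M4-2 (journal); `SCOPE-alpha.md` v2.2 §5 row M4 — PRE-POSITIONING ONLY)

Summits-side support leaf of the T⁴-continuum cell (rung (B)+1 on a FINITE torus only; NOT infinite volume, NOT the
mass gap, NOT the Clay statement; NOT a proof of the spine estimate NE7b, which is the cell's OWN estimate, NOT PRINTED
and NOT PROVED).  [folklore] finite combinatorics in the ℤᵈ index model over row S3's `HistoryGen.chainJoin` (the
END's `Pedigree.toPGen` joins the parts of a component by `chainJoin A Bs s` = LEFT-nested, parts listed OLDEST LINE
FIRST, `HistoryGenTimed.Pedigree.HeadOldest`), the print-exact core `HistoryRealisePrint` (`RealisesP`,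
`PendingBefore`), row S14 (`img`, `unionL`, `pendingBefore_self`), brick 2 of M3b-2 (`HistoryTouchComponents`) and b02's
`touchGraph`∕`GConn`; nothing printed is asserted, zero `sorry`.  B16 = [Balaban1989LargeFieldII] p. 386 under audit;
locator only (the maximal tree in `G`).

WHY.  Row S14∕S14-R realise the RIGHT-nested chain `joinTail` in LEAF-FIRST order (each constituent touches the union of
the LATER ones).  The END reads components through `Pedigree.toPGen`, whose chain is LEFT-nested and headed by the
OLDEST line; the order it needs is «each part touches the union of the EARLIER parts» with a PRESCRIBED head.  This
brick supplies both facts in that form, so the junction M4 can realise `toPGen` of the pedigree built from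
`RunInput.hist` (D-M4-4) by the invariant method of brick 4.

WHAT IS DEFINED AND PROVED.  §1 `bigU U Bs` (the running union `((U ∪ B₁) ∪ B₂) ∪ …`, a `foldl`), `subset_bigU_self`,
`subset_bigU_of_mem`, `bigU_subset`; **`TouchPrefix U Bs`** (each domain touches the running union of the head domain
`U` and the domains before it), `touchPrefix_append_singleton`.  §2 **`realisesP_chainJoin`**: head `A` realised by `ZA`,
further parts each realised, all with `lastStep ≤ s` and `PendingBefore … s`, images in `TouchPrefix` order from the
head's image, `Z` inside the union of all images ⟹ `RealisesP L s R (chainJoin A (parts) s) Z` (induction: the inner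
join is realised by the running union and is pending at its own step).  §3 **`exists_touchPrefix_enum_from`**: a family
with connected induced touch graph and a PRESCRIBED member `v₀` has a duplicate-free enumeration `v₀ :: rest` of the
whole family with `TouchPrefix (P v₀) (rest.map P)` — greedy APPENDING of a member adjacent to the current list (a
boundary dart, brick 1 of S14's ORDER module); `exists_touchPrefix_enum_from_of_mem_tcomps` (per block of brick 2).

HONEST.  Proves nothing of Bałaban's; NE7b NOT proved; spine 0∕9.  HONEST DEPENDENCY (cell): continuum YM on T⁴ ⇐
BetaPertH ∧ nine spine estimates (0/9 proved); BetaPertH ⇐ (D1) ∧ (D4) ∧ CAP+tail; G-an2-4 gates asym, D1 and NE2/3/4.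
This file changes none of it. -/

open Finset
open Literature.MathematicalPhysics.QuantumFieldTheory.Balaban1983to89
open Literature.MathematicalPhysics.QuantumFieldTheory.Balaban1983to89.B13ScaleTransfer
open Literature.MathematicalPhysics.QuantumFieldTheory.Balaban1983to89.B16MergeGeometry
open Literature.MathematicalPhysics.QuantumFieldTheory.Balaban1983to89.Step.Budget
open Summit.QuantumFields.BalabanUV.T4Continuum.HistoryAdmissible
open Summit.QuantumFields.BalabanUV.T4Continuum.HistoryRealise
open Summit.QuantumFields.BalabanUV.T4Continuum.HistoryRealisePrint
open Summit.QuantumFields.BalabanUV.T4Continuum.HistoryGen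
open Summit.QuantumFields.BalabanUV.T4Continuum.HistoryTouchComponents

namespace Summit.QuantumFields.BalabanUV.T4Continuum.HistoryGenealogyRealise

noncomputable section

variable {d : ℕ}

/-! ## §1 Running unions and the prefix-touch order -/

/-- the running union of a head domain and a list of further domains (left fold) [folklore] -/
def bigU (U : Finset (Pt d)) (Bs : List (Finset (Pt d))) : Finset (Pt d) := Bs.foldl (· ∪ ·) U

/-- `bigU` of the empty list [folklore] -/
@[simp] theorem bigU_nil (U : Finset (Pt d)) : bigU U [] = U := rfl

/-- `bigU` one step [folklore] -/
@[simp] theorem bigU_cons (U B : Finset (Pt d)) (Bs : List (Finset (Pt d))) : bigU U (B :: Bs) = bigU (U ∪ B) Bs := rfl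

/-- the head lies in the running union [folklore] -/
theorem subset_bigU_self (U : Finset (Pt d)) : ∀ Bs : List (Finset (Pt d)), U ⊆ bigU U Bs
  | [] => subset_rfl
  | B :: Bs => (Finset.subset_union_left).trans (subset_bigU_self (U ∪ B) Bs)

/-- a listed domain lies in the running union [folklore] -/
theorem subset_bigU_of_mem {B : Finset (Pt d)} : ∀ {U : Finset (Pt d)} {Bs : List (Finset (Pt d))}, B ∈ Bs → B ⊆ bigU U Bs
  | U, B' :: Bs, h => by
      rcases List.mem_cons.1 h with rfl | h
      · exact (Finset.subset_union_right).trans (subset_bigU_self (U ∪ B) Bs)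
      · exact subset_bigU_of_mem (U := U ∪ B') h
  | _, [], h => by simp at h

/-- the running union lies in the head united with `unionL` of the list [folklore] -/
theorem bigU_subset : ∀ (U : Finset (Pt d)) (Bs : List (Finset (Pt d))), bigU U Bs ⊆ U ∪ unionL Bs
  | U, [] => by simp
  | U, B :: Bs => by
      rw [bigU_cons, unionL_cons]
      refine (bigU_subset (U ∪ B) Bs).trans ?_
      intro x hx
      simp only [Finset.mem_union] at hx ⊢
      tauto

/-- **`TouchPrefix U Bs`**: each domain of the list touches the running union of the head `U` and the domains listed
before it (the contact order of a LEFT-nested join chain headed by `U`). [folklore] -/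
def TouchPrefix : Finset (Pt d) → List (Finset (Pt d)) → Prop
  | _, [] => True
  | U, B :: Bs => (∃ a ∈ U, ∃ c ∈ B, Touch a c) ∧ TouchPrefix (U ∪ B) Bs

/-- `TouchPrefix` of the empty list [folklore] -/
@[simp] theorem touchPrefix_nil (U : Finset (Pt d)) : TouchPrefix U [] := trivial

/-- `TouchPrefix` one step [folklore] -/
@[simp] theorem touchPrefix_cons (U B : Finset (Pt d)) (Bs : List (Finset (Pt d))) :
    TouchPrefix U (B :: Bs) ↔ (∃ a ∈ U, ∃ c ∈ B, Touch a c) ∧ TouchPrefix (U ∪ B) Bs := Iff.rfl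

/-- APPENDING a domain that touches the running union keeps the prefix-touch order [folklore] -/
theorem touchPrefix_append_singleton :
    ∀ (U : Finset (Pt d)) (Bs : List (Finset (Pt d))) (B : Finset (Pt d)),
      TouchPrefix U (Bs ++ [B]) ↔ TouchPrefix U Bs ∧ ∃ a ∈ bigU U Bs, ∃ c ∈ B, Touch a c
  | U, [], B => by simp [TouchPrefix]
  | U, B' :: Bs, B => by
      rw [List.cons_append, touchPrefix_cons, touchPrefix_cons, touchPrefix_append_singleton (U ∪ B') Bs B, bigU_cons]
      tauto

/-! ## §2 Left-nested join chains realised (print-exact pendency) -/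

section ChainJoin

variable {L : ℕ} {s R : ℕ → ℕ}

/-- **LEFT-NESTED JOIN CHAINS REALISED.**  Head `A` realised by `ZA`, further parts `Bs` (each realised by its listed
domain), all with `lastStep ≤ sj` and pending STRICTLY BEFORE `sj`, the parts' images in `TouchPrefix` order from the
head's image, and a domain `Z` inside the union of all images ⟹ `RealisesP (chainJoin A (Bs.map Prod.fst) sj) Z`
(for a nonempty `Bs`). [folklore] -/
theorem realisesP_chainJoin (sj : ℕ) :
    ∀ (A : PGen (Lab d)) (ZA : Finset (Pt d)) (Bs : List (PGen (Lab d) × Finset (Pt d))), Bs ≠ [] →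
      RealisesP L s R A ZA → A.lastStep ≤ sj → PendingBefore L s R A.lastStep ZA sj →
      (∀ BZ ∈ Bs, RealisesP L s R BZ.1 BZ.2 ∧ BZ.1.lastStep ≤ sj ∧ PendingBefore L s R BZ.1.lastStep BZ.2 sj) →
      TouchPrefix (img L s sj (A, ZA)) (Bs.map (img L s sj)) →
      ∀ Z, Z ⊆ img L s sj (A, ZA) ∪ unionL (Bs.map (img L s sj)) →
        RealisesP L s R (chainJoin A (Bs.map Prod.fst) sj) Z
  | _, _, [], hne, _, _, _, _, _, _, _ => (hne rfl).elim
  | A, ZA, [BZ], _, hA, hAs, hAp, hall, hct, Z, hZ => by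
      obtain ⟨hB, hBs, hBp⟩ := hall BZ (by simp)
      have hct' : (∃ a ∈ img L s sj (A, ZA), ∃ c ∈ img L s sj BZ, Touch a c) := by
        simpa [TouchPrefix] using hct
      obtain ⟨a, ha, c, hc, hac⟩ := hct'
      have hZ' : Z ⊆ img L s sj (A, ZA) ∪ img L s sj BZ := by simpa using hZ
      show RealisesP L s R (PGen.join A BZ.1 sj) Z
      exact ⟨ZA, BZ.2, hA, hB, hAs, hBs, hAp, hBp, ⟨a, ha, c, hc, hac⟩, hZ'⟩
  | A, ZA, BZ :: CZ :: Bs, _, hA, hAs, hAp, hall, hct, Z, hZ => by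
      obtain ⟨hB, hBs, hBp⟩ := hall BZ (by simp)
      rw [List.map_cons, touchPrefix_cons] at hct
      obtain ⟨⟨a, ha, c, hc, hac⟩, hrest⟩ := hct
      -- the inner join, realised by the running union of the two images
      set A' : PGen (Lab d) := PGen.join A BZ.1 sj with hA'
      set ZA' : Finset (Pt d) := img L s sj (A, ZA) ∪ img L s sj BZ with hZA'
      have hreal' : RealisesP L s R A' ZA' :=
        ⟨ZA, BZ.2, hA, hB, hAs, hBs, hAp, hBp, ⟨a, ha, c, hc, hac⟩, subset_rfl⟩
      have hlast' : A'.lastStep = sj := rfl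
      have himg' : img L s sj (A', ZA') = ZA' := by simp [img, hlast']
      show RealisesP L s R (chainJoin (PGen.join A BZ.1 sj) ((CZ :: Bs).map Prod.fst) sj) Z
      refine realisesP_chainJoin sj A' ZA' (CZ :: Bs) (by simp) hreal' hlast'.le
        (by rw [hlast']; exact ⟨le_rfl, fun k hk _ => by omega⟩)
        (fun W hW => hall W (by simp only [List.mem_cons] at hW ⊢; exact Or.inr hW)) ?_ Z ?_
      · rw [himg']; exact hrest
      · rw [himg']
        intro x hx
        have hx' := hZ hx
        simp only [List.map_cons, unionL_cons, Finset.mem_union, hZA'] at hx' ⊢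
        tauto

end ChainJoin

/-! ## §3 The oldest-first contact order exists: greedy appending from a prescribed head -/

section Order

variable {ι : Type*} [DecidableEq ι]

/-- **GREEDY FROM A PRESCRIBED HEAD.**  If the touch graph induced on `S` is connected and `v₀ ∈ S`, then for every
`k ≤ #S`, `1 ≤ k`, there is a duplicate-free list `v₀ :: rest` of `k` members of `S` with `TouchPrefix (P v₀) (rest.map
P)`: extend by APPENDING a member outside the list adjacent to one inside. [folklore] -/
theorem exists_touchPrefix_list_from (P : ι → Finset (Pt d)) {S : Finset ι} (hG : GConn (touchGraph P) S) {v₀ : ι}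
    (hv₀ : v₀ ∈ S) : ∀ k, 1 ≤ k → k ≤ S.card →
      ∃ rest : List ι, (v₀ :: rest).Nodup ∧ (∀ i ∈ v₀ :: rest, i ∈ S) ∧ (v₀ :: rest).length = k ∧
        TouchPrefix (P v₀) (rest.map P)
  | 0, h1, _ => by omega
  | 1, _, _ => ⟨[], List.nodup_singleton v₀, by simpa using hv₀, rfl, by simp⟩
  | k + 2, _, hk => by
      obtain ⟨rest, hnd, hsub, hlen, htp⟩ := exists_touchPrefix_list_from P hG hv₀ (k + 1) (by omega) (by omega)
      set T : Finset ι := (v₀ :: rest).toFinset with hT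
      have hTS : T ⊆ S := fun i hi => hsub i (List.mem_toFinset.1 hi)
      have hcard : T.card = k + 1 := by rw [hT, List.toFinset_card_of_nodup hnd]; exact hlen
      obtain ⟨y, hyS, hyT⟩ := Finset.exists_mem_notMem_of_card_lt_card (s := T) (t := S) (by omega)
      obtain ⟨u, huT, v, hvS, hvT, hadj⟩ :=
        exists_adj_out_of_gconn P hG hTS (x := v₀) (List.mem_toFinset.2 (by simp)) hyS hyT
      obtain ⟨-, a, ha, c, hc, hac⟩ := (touchGraph_adj P u v).1 hadj
      have hv_notin : v ∉ v₀ :: rest := fun h => hvT (List.mem_toFinset.2 h)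
      refine ⟨rest ++ [v], ?_, ?_, by simp [← hlen], ?_⟩
      · rw [← List.cons_append]
        exact List.nodup_append.2 ⟨hnd, List.nodup_singleton v, by
          intro x hx y hy; rw [List.mem_singleton] at hy; subst hy; exact fun h => hv_notin (h ▸ hx)⟩
      · intro i hi
        rw [← List.cons_append, List.mem_append] at hi
        rcases hi with hi | hi
        · exact hsub i hi
        · rw [List.mem_singleton] at hi; subst hi; exact hvS
      · rw [List.map_append, List.map_singleton, touchPrefix_append_singleton]
        refine ⟨htp, a, ?_, c, hc, hac⟩
        have hu : u ∈ v₀ :: rest := List.mem_toFinset.1 huT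
        rcases List.mem_cons.1 hu with rfl | hu
        · exact subset_bigU_self _ _ ha
        · exact subset_bigU_of_mem (List.mem_map.2 ⟨u, hu, rfl⟩) ha

/-- **THE OLDEST-FIRST CONTACT ORDER EXISTS**: a family with connected induced touch graph has, for every prescribed
member `v₀`, a duplicate-free enumeration `v₀ :: rest` in `TouchPrefix` order from `P v₀`. [folklore] -/
theorem exists_touchPrefix_enum_from (P : ι → Finset (Pt d)) {S : Finset ι} (hG : GConn (touchGraph P) S) {v₀ : ι}
    (hv₀ : v₀ ∈ S) :
    ∃ rest : List ι, (v₀ :: rest).Nodup ∧ (v₀ :: rest).toFinset = S ∧ TouchPrefix (P v₀) (rest.map P) := by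
  have hpos : 1 ≤ S.card := Finset.card_pos.2 ⟨v₀, hv₀⟩
  obtain ⟨rest, hnd, hsub, hlen, htp⟩ := exists_touchPrefix_list_from P hG hv₀ S.card hpos le_rfl
  refine ⟨rest, hnd, Finset.eq_of_subset_of_card_le (fun i hi => hsub i (List.mem_toFinset.1 hi)) ?_, htp⟩
  rw [List.toFinset_card_of_nodup hnd, hlen]

end Order

/-- per block of brick 2: every block has an oldest-first (indeed, any-head-first) contact enumeration [folklore] -/
theorem exists_touchPrefix_enum_from_of_mem_tcomps {ι : Type*} [DecidableEq ι] (P : ι → Finset (Pt d)) {S T : Finset ι}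
    (hT : T ∈ tcomps P S) {v₀ : ι} (hv₀ : v₀ ∈ T) :
    ∃ rest : List ι, (v₀ :: rest).Nodup ∧ (∀ x, x ∈ v₀ :: rest ↔ x ∈ T) ∧ TouchPrefix (P v₀) (rest.map P) := by
  classical
  obtain ⟨rest, hnd, hts, htp⟩ := exists_touchPrefix_enum_from P (gconn_of_mem_tcomps hT) hv₀
  exact ⟨rest, hnd, fun x => by simpa only [List.mem_toFinset] using Finset.ext_iff.1 hts x, htp⟩

/-! ## §4 Sanity (`ℤ¹`): the prefix-touch order of three unit domains in a row from the left end -/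

namespace SanityChain

open B16MergeGeometry.OneDim

/-- `[{1}, {2}]` is in `TouchPrefix` order from `{0}`: `{1}` touches `{0}`, `{2}` touches `{0} ∪ {1}` [folklore] -/
example : TouchPrefix ({pt 0} : Finset (Pt 1)) [{pt 1}, {pt 2}] := by
  refine ⟨⟨pt 0, by simp, pt 1, by simp, fun _ => by simp only [pt]; omega⟩, ?_, trivial⟩
  exact ⟨pt 1, by simp, pt 2, by simp, fun _ => by simp only [pt]; omega⟩

end SanityChain

end

end Summit.QuantumFields.BalabanUV.T4Continuum.HistoryGenealogyRealise
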